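import Summits.KontsevichZagierPeriods.KontsevichZagierPeriods.Theorems.SoloBlindQuarticSecondPrep
import Literature.NumberTheory.Transcendental.KZBetaChains
import HarnessLib

/-!
# Quartic family, second kind — part II: the relation in `Q` and the orbit merge

Sol Binde (solo-blind track), 2026-08-20.

With the three pulled-back integrands `G_A, G_B, G_C` and the primitive `P` of
`SoloBlindQuarticSecondPrep` (`P' = ((1-4y)/4)64^y G_C - 3y G_B + y G_A`, `P(0)=P(1)=0`), the KZ
chain  three substitutions → one Newton–Leibniz move → two additivity splits  gives, for every
rational `0 < y < 1/4`, the SECOND-KIND quartic relation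

  `3y • β(1-y, 4y) - y • β(4y, 1-3y) = ((1-4y)/4)·64^{y} • β(1-3y, ½+y)`      (in `Q`)

(all three Betas of the second kind: parameter sums `1+3y`, `1+y`, `3/2-2y`).  Combined with the
second-kind orbit relation (`betaQ_second_rat`) it merges the orbit of `{1-y, 4y, 1-3y}` with that
of `{1-3y, ½+y, ½-2y}`: `β(1-y,4y) ≐ β(1-3y, ½+y)`.  Instances: levels `8`, `5`, `12`, `16`.

Sources: Aoki–Shioda standard cycles (J. Math. Soc. Japan 39 (1987), doi:10.2969/jmsj/03930385);
this explicit one-dimensional realisation appears to be new.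
-/

open MeasureTheory Set Real MvPolynomial
open Literature.NumberTheory.Transcendental
open Literature.NumberTheory.Transcendental.KZ
open Literature.NumberTheory.Transcendental.KZ.IntegralRep
open Literature.ModelTheory.ExponentialFields

noncomputable section

namespace Summit.KontsevichZagierPeriods.KontsevichZagierPeriods.Theorems

namespace SoloBlind

variable {y : ℚ}

/-! ## On the closed interval -/

/-- `P` is `ℚ`-semialgebraic on `[0,1]` (`0 < y < 1/3`). -/
theorem sa_qsP (hy : 0 < y) (hy3 : 3 * y < 1) :
    IsSemialgebraicFunOn ℚ (line (Icc 0 1)) fun v => qsP y (v 0) := by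
  refine isSemialgebraicFunOn_Icc_of_Ioo ?_ 0 0 (fun x hx => ?_) (fun x hx => ?_)
  · refine (sa_qs_shape y (X 0) (1 + X 0 ^ 2) fun v _ => ?_).congr fun v hv => ?_
    · have : (0:ℝ) < 1 + v 0 ^ 2 := by positivity
      simpa using this.ne'
    · have hv' : v 0 ∈ Ioo (0:ℝ) 1 := hv
      simp [qsP_eq hv', mul_div_assoc]
  · rw [hx, qsP_zero hy3, Rat.cast_zero]
  · rw [hx, qsP_one hy, Rat.cast_zero]

/-- The exact integrand is `ℚ`-semialgebraic on `[0,1]`. -/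
theorem sa_qsE (y : ℚ) : IsSemialgebraicFunOn ℚ (line (Icc 0 1)) fun v => qsE y (v 0) := by
  refine isSemialgebraicFunOn_Icc_of_Ioo (sa_qsE_Ioo y) 0 0 (fun x hx => ?_) (fun x hx => ?_)
  · have h0 : x 0 ∉ Ioo (0:ℝ) 1 := fun h => by rw [hx] at h; exact lt_irrefl _ h.1
    rw [qsE, if_neg h0, Rat.cast_zero]
  · have h0 : x 0 ∉ Ioo (0:ℝ) 1 := fun h => by rw [hx] at h; exact lt_irrefl _ h.2
    rw [qsE, if_neg h0, Rat.cast_zero]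

/-- The exact integrand is integrable on `[0,1]`. -/
theorem integrableOn_qsE (hy : 0 < y) (hy4 : 4 * y < 1) : IntegrableOn (qsE y) (Icc 0 1) := by
  rw [integrableOn_Icc_iff_integrableOn_Ioo]
  exact IntegrableOn.congr_fun
    ((((integrableOn_qsGC y hy hy4).const_mul ((64:ℝ) ^ (y : ℝ))).const_mul
      ((((1 - 4 * y) / 4 : ℚ)) : ℝ)).add
      (((integrableOn_qsGB y hy hy4).const_mul ((((-(3 * y)) : ℚ)) : ℝ)).add
        ((integrableOn_qsGA y hy hy4).const_mul (((y : ℚ)) : ℝ))))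
    (fun v hv => by simp only [qsE, if_pos hv, Pi.add_apply]) measurableSet_Ioo

/-! ## The coefficient `κ_y = ((1-4y)/4)·64^{y}` -/

/-- `κ_y` is algebraic. -/
theorem isAlgebraic_qsC (y : ℚ) :
    IsAlgebraic ℚ (((((1 - 4 * y) / 4 : ℚ)) : ℝ) * (64:ℝ) ^ (y : ℝ)) :=
  (isAlgebraic_rat ℚ _).mul (qu_isAlgebraic_rpow y)

/-- `κ_y` as an element of `K₀`. -/
def qsCK (y : ℚ) : K₀ :=
  ⟨((((1 - 4 * y) / 4 : ℚ)) : ℝ) * (64:ℝ) ^ (y : ℝ), mem_K₀_iff.mpr (isAlgebraic_qsC y)⟩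

/-- `(κ_y : ℝ) = ((1-4y)/4)·64^{y}`. -/
@[simp] theorem coe_qsCK (y : ℚ) :
    ((qsCK y : K₀) : ℝ) = ((((1 - 4 * y) / 4 : ℚ)) : ℝ) * (64:ℝ) ^ (y : ℝ) := rfl

/-- `κ_y ≠ 0` for `y < 1/4`. -/
theorem qsCK_ne_zero (hy4 : 4 * y < 1) : qsCK y ≠ 0 := by
  intro h
  have h' := congrArg (fun z : K₀ => (z : ℝ)) h
  simp only [coe_qsCK, ZeroMemClass.coe_zero] at h'
  have h1 : (0:ℝ) < ((((1 - 4 * y) / 4 : ℚ)) : ℝ) := by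
    have : (0:ℚ) < (1 - 4 * y) / 4 := by linarith
    exact_mod_cast this
  have : (0:ℝ) < ((((1 - 4 * y) / 4 : ℚ)) : ℝ) * (64:ℝ) ^ (y : ℝ) := by positivity
  linarith

/-! ## The representations and the moves -/

/-- `R_A = [(0,1), G_A]`. -/
def qsRA (y : ℚ) (hy : 0 < y) (hy4 : 4 * y < 1) : IntegralRep 1 :=
  lineRep (Ioo 0 1) (qsGA y) mix_line_sa (sa_qsGA y) (integrableOn_qsGA y hy hy4)

/-- `R_B = [(0,1), G_B]`. -/
def qsRB (y : ℚ) (hy : 0 < y) (hy4 : 4 * y < 1) : IntegralRep 1 :=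
  lineRep (Ioo 0 1) (qsGB y) mix_line_sa (sa_qsGB y) (integrableOn_qsGB y hy hy4)

/-- `R_C = [(0,1), G_C]`. -/
def qsRC (y : ℚ) (hy : 0 < y) (hy4 : 4 * y < 1) : IntegralRep 1 :=
  lineRep (Ioo 0 1) (qsGC y) mix_line_sa (sa_qsGC y) (integrableOn_qsGC y hy hy4)

/-- The combination `W = -3y·G_B + y·G_A`. -/
def qsW (y : ℚ) (m : ℝ) : ℝ := (((-(3 * y) : ℚ)) : ℝ) * qsGB y m + ((y : ℚ) : ℝ) * qsGA y m

/-- `[(0,1), W]`. -/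
def qsWRep (y : ℚ) (hy : 0 < y) (hy4 : 4 * y < 1) : IntegralRep 1 :=
  lineRep (Ioo 0 1) (qsW y) mix_line_sa
    (((isSemialgebraicFunOn_const_of_isAlgebraic mix_line_sa
      (isAlgebraic_rat ℚ (-(3 * y)))).mul_holds (sa_qsGB y)).add_holds
      ((isSemialgebraicFunOn_const_of_isAlgebraic mix_line_sa
        (isAlgebraic_rat ℚ y)).mul_holds (sa_qsGA y)))
    (((integrableOn_qsGB y hy hy4).const_mul _).add ((integrableOn_qsGA y hy hy4).const_mul _))

/-- `X = [[0,1], P']`. -/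
def qsExact (y : ℚ) (hy : 0 < y) (hy4 : 4 * y < 1) : IntegralRep 1 :=
  lineRep (Icc 0 1) (qsE y) (isSemialgebraic_line_Icc isAlgebraic_zero isAlgebraic_one)
    (sa_qsE y) (integrableOn_qsE hy hy4)

/-- **Move A (substitution `σ = φ_A(m)`):** `R_A ≡ β(4y, 1-3y)`. -/
theorem qsRA_sub_betaRep (y : ℚ) (hy : 0 < y) (hy4 : 4 * y < 1) :
    of (qsRA y hy hy4) - of (betaRep (4 * y) (1 - 3 * y) (by positivity) (by linarith)) ∈
      relations := by
  unfold qsRA betaRep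
  exact lineRep_subst quA quA' sa_quA (fun m _ => (hasDerivAt_quA m).hasDerivWithinAt) injOn_quA
    image_quA (fun m hm => qs_pullA y hm)

/-- **Move B (substitution `σ = φ_B(m)`):** `R_B ≡ β(1-y, 4y)`. -/
theorem qsRB_sub_betaRep (y : ℚ) (hy : 0 < y) (hy4 : 4 * y < 1) :
    of (qsRB y hy hy4) - of (betaRep (1 - y) (4 * y) (by linarith) (by positivity)) ∈
      relations := by
  unfold qsRB betaRep
  exact lineRep_subst quB quB' sa_quB (fun m _ => (hasDerivAt_quB m).hasDerivWithinAt) injOn_quB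
    image_quB (fun m hm => qs_pullB y hm)

/-- **Move C (substitution `s = ψ(m)`):** `R_C ≡ β(1-3y, ½+y)`. -/
theorem qsRC_sub_betaRep (y : ℚ) (hy : 0 < y) (hy4 : 4 * y < 1) :
    of (qsRC y hy hy4) - of (betaRep (1 - 3 * y) (1 / 2 + y) (by linarith) (by positivity)) ∈
      relations := by
  unfold qsRC betaRep
  exact lineRep_subst quS quS' sa_quS (fun m _ => (hasDerivAt_quS m).hasDerivWithinAt) injOn_quS
    image_quS (fun m hm => qs_pullC y hm)

/-- **Move D, rule (3) (Newton–Leibniz):** `[[0,1], P'] ∈ relations`, since `P(1) - P(0) = 0`. -/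
theorem qsExact_mem (y : ℚ) (hy : 0 < y) (hy4 : 4 * y < 1) :
    of (qsExact y hy hy4) ∈ relations := by
  have hy3 : 3 * y < 1 := by linarith
  have h0 : qsP y 1 - qsP y 0 = 0 := by rw [qsP_one hy, qsP_zero hy3, sub_zero]
  have h1 : of (qsExact y hy hy4) -
      of (constCell (qsP y 1 - qsP y 0) (by rw [h0]; exact isAlgebraic_zero)) ∈ relations :=
    lineRep_newtonLeibniz isAlgebraic_zero isAlgebraic_one zero_le_one (qsP y)
      (sa_qsP hy hy3) (continuous_qsP hy hy3).continuousOn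
      fun t ht => hasDerivAt_qsP ht
  have hc : of (constCell (qsP y 1 - qsP y 0) (by rw [h0]; exact isAlgebraic_zero)) ∈
      relations := by
    rw [constCell_congr h0 (hβ := isAlgebraic_zero)]
    exact constCell_zero
  simpa using relations.add_mem h1 hc

/-- `X⁰ = [(0,1), P']`, the open restriction. -/
def qsExactO (y : ℚ) (hy : 0 < y) (hy4 : 4 * y < 1) : IntegralRep 1 :=
  (qsExact y hy hy4).restrict (line (Ioo 0 1)) mix_line_sa fun _ hx => Ioo_subset_Icc_self hx

/-- `[(0,1), P'] ∈ relations`. -/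
theorem qsExactO_mem (y : ℚ) (hy : 0 < y) (hy4 : 4 * y < 1) :
    of (qsExactO y hy hy4) ∈ relations := by
  have h1 : of (qsExact y hy hy4) - of (qsExactO y hy hy4) ∈ relations := by
    refine IntegralRep.of_sub_of_restrict_mem_relations _ _ _ ?_
    show volume (line (Icc (0 : ℝ) 1) \ line (Ioo 0 1)) = 0
    rw [← show line (Icc (0 : ℝ) 1 \ Ioo 0 1) = line (Icc (0 : ℝ) 1) \ line (Ioo 0 1) from rfl,
      volume_line, Icc_sdiff_Ioo_same zero_le_one]
    exact (toFinite _).measure_zero _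
  have h2 := relations.sub_mem (qsExact_mem y hy hy4) h1
  rwa [sub_sub_cancel] at h2

/-- **Move E, rule (1b):** `[(0,1), P'] ≡ κ_y•R_C + [(0,1), W]`. -/
theorem qsExactO_sub_sub (y : ℚ) (hy : 0 < y) (hy4 : 4 * y < 1) :
    of (qsExactO y hy hy4) -
      of ((qsRC y hy hy4).constMul _ (isAlgebraic_qsC y)) - of (qsWRep y hy hy4) ∈ relations := by
  refine of_sub_sub_mem_relations_of_add rfl rfl fun x hx => ?_
  have hx' : x 0 ∈ Ioo (0 : ℝ) 1 := hx
  simp only [qsExactO, IntegralRep.integrand_restrict, qsExact, lineRep_integrand,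
    IntegralRep.integrand_constMul, qsRC, qsWRep]
  rw [qsE, if_pos hx', qsW]
  ring

/-- **Move F, rule (1b):** `[(0,1), W] ≡ (-3y)•R_B + y•R_A`. -/
theorem qsWRep_sub_sub (y : ℚ) (hy : 0 < y) (hy4 : 4 * y < 1) :
    of (qsWRep y hy hy4) -
      of ((qsRB y hy hy4).constMul ((((-(3 * y)) : ℚ)) : ℝ) (isAlgebraic_rat ℚ (-(3 * y)))) -
      of ((qsRA y hy hy4).constMul (((y : ℚ)) : ℝ) (isAlgebraic_rat ℚ y)) ∈ relations :=
  of_sub_sub_mem_relations_of_add rfl rfl fun _ _ => rfl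

/-! ## Assembly in `Q` -/

/-- `[R_A] = β(4y, 1-3y)`. -/
theorem qsRA_eq (y : ℚ) (hy : 0 < y) (hy4 : 4 * y < 1) :
    mkQ (of (qsRA y hy hy4)) = betaQ (4 * y) (1 - 3 * y) := by
  rw [betaQ_eq (by positivity) (by linarith)]
  exact mkQ_eq_mkQ_iff.mpr (qsRA_sub_betaRep y hy hy4)

/-- `[R_B] = β(1-y, 4y)`. -/
theorem qsRB_eq (y : ℚ) (hy : 0 < y) (hy4 : 4 * y < 1) :
    mkQ (of (qsRB y hy hy4)) = betaQ (1 - y) (4 * y) := by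
  rw [betaQ_eq (by linarith) (by positivity)]
  exact mkQ_eq_mkQ_iff.mpr (qsRB_sub_betaRep y hy hy4)

/-- `[R_C] = β(1-3y, ½+y)`. -/
theorem qsRC_eq (y : ℚ) (hy : 0 < y) (hy4 : 4 * y < 1) :
    mkQ (of (qsRC y hy hy4)) = betaQ (1 - 3 * y) (1 / 2 + y) := by
  rw [betaQ_eq (by linarith) (by positivity)]
  exact mkQ_eq_mkQ_iff.mpr (qsRC_sub_betaRep y hy hy4)

/-- `[(0,1), W] = (-3y)•β(1-y,4y) + y•β(4y,1-3y)` in `Q`. -/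
theorem mkQ_qsWRep (y : ℚ) (hy : 0 < y) (hy4 : 4 * y < 1) :
    mkQ (of (qsWRep y hy hy4)) =
      ((-(3 * y) : ℚ) : K₀) • betaQ (1 - y) (4 * y) + ((y : ℚ) : K₀) • betaQ (4 * y) (1 - 3 * y) := by
  have h1 := qsWRep_sub_sub y hy hy4
  rw [sub_sub] at h1
  have h2 := mkQ_eq_mkQ_iff.mpr h1
  rwa [map_add, mkQ_constMul_ratCast, mkQ_constMul_ratCast, qsRB_eq, qsRA_eq] at h2

/-- `κ_y•β(1-3y,½+y) + [(0,1),W] = 0` in `Q`. -/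
theorem qsC_add_qsW_eq_zero (y : ℚ) (hy : 0 < y) (hy4 : 4 * y < 1) :
    qsCK y • betaQ (1 - 3 * y) (1 / 2 + y) + mkQ (of (qsWRep y hy hy4)) = 0 := by
  have h1 := relations.sub_mem (qsExactO_sub_sub y hy hy4) (qsExactO_mem y hy hy4)
  have e : of (qsExactO y hy hy4) - of ((qsRC y hy hy4).constMul _ (isAlgebraic_qsC y)) -
      of (qsWRep y hy hy4) - of (qsExactO y hy hy4) =
      -(of ((qsRC y hy hy4).constMul _ (isAlgebraic_qsC y)) + of (qsWRep y hy hy4)) := by abel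
  rw [e] at h1
  have h1' := relations.neg_mem h1
  rw [neg_neg] at h1'
  have h2 := mkQ_eq_zero_iff.mpr h1'
  rw [map_add, mkQ_constMul, qsRC_eq] at h2
  exact h2

/-- **The quartic family of the second kind inside the Kontsevich–Zagier rules:**
`3y • β(1-y, 4y) - y • β(4y, 1-3y) = ((1-4y)/4)·64^{y} • β(1-3y, ½+y)` for rational `0 < y < 1/4` —
three substitutions, ONE Newton–Leibniz move, two additivity splits, no division. -/
theorem betaQ_quarticSecond (y : ℚ) (hy : 0 < y) (hy4 : 4 * y < 1) :
    ((3 * y : ℚ) : K₀) • betaQ (1 - y) (4 * y) - ((y : ℚ) : K₀) • betaQ (4 * y) (1 - 3 * y) =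
      qsCK y • betaQ (1 - 3 * y) (1 / 2 + y) := by
  have h := qsC_add_qsW_eq_zero y hy hy4
  rw [mkQ_qsWRep y hy hy4] at h
  rw [eq_neg_of_add_eq_zero_left h]
  push_cast
  module

/-- Period check: `3y·B(1-y,4y) - y·B(4y,1-3y) = ((1-4y)/4)·64^{y}·B(1-3y,½+y)`. -/
theorem beta_quarticSecond_value (y : ℚ) (hy : 0 < y) (hy4 : 4 * y < 1) :
    3 * (y : ℝ) * evalQ (betaQ (1 - y) (4 * y)) - (y : ℝ) * evalQ (betaQ (4 * y) (1 - 3 * y)) =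
      ((1 - 4 * (y : ℝ)) / 4) * (64:ℝ) ^ (y : ℝ) * evalQ (betaQ (1 - 3 * y) (1 / 2 + y)) := by
  have h := congrArg evalQ (betaQ_quarticSecond y hy hy4)
  rw [map_sub, evalQ_smul, evalQ_smul, evalQ_smul, coe_qsCK] at h
  push_cast at h
  exact h

/-! ## The orbit merge -/

/-- `sin(π(1-a)) = sin(πa)` in `K₀`. -/
theorem sinQ_one_sub (a : ℚ) : sinQ (1 - a) = sinQ a := by
  apply Subtype.ext
  rw [sinQ_val, sinQ_val]
  push_cast
  rw [mul_sub, mul_one, Real.sin_pi_sub]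

/-- **Second-kind quartic merge: `β(1-y, 4y) ≐ β(1-3y, ½+y)`** for every rational `0 < y < 1/4`:
the orbit of `{1-y, 4y, 1-3y}` meets that of `{1-3y, ½+y, ½-2y}`.  Precisely
`3y(sin 3πy - sin πy) • β(1-y, 4y) = (κ_y sin 3πy) • β(1-3y, ½+y)`. -/
theorem betaQ_propTo_quarticSecond (y : ℚ) (hy : 0 < y) (hy4 : 4 * y < 1) :
    PropTo (betaQ (1 - y) (4 * y)) (betaQ (1 - 3 * y) (1 / 2 + y)) := by
  have key := betaQ_quarticSecond y hy hy4
  -- second-kind orbit relation: y sin(3πy) β(4y,1-3y) = 3y sin(πy) β(1-y,4y)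
  have hp := betaQ_second_rat (1 - 3 * y) (1 - y) (by linarith) (by linarith) (by linarith)
  rw [show (2:ℚ) - (1 - 3 * y) - (1 - y) = 4 * y by ring, show (1:ℚ) - (1 - y) = y by ring,
    show (1:ℚ) - (1 - 3 * y) = 3 * y by ring, sinQ_one_sub, sinQ_one_sub,
    betaQ_symm (show (0:ℚ) < 1 - 3 * y by linarith) (show (0:ℚ) < 4 * y by positivity)] at hp
  -- hp : (y:K₀) • sinQ (3y) • betaQ (4y) (1-3y) = ((3y):K₀) • sinQ y • betaQ (1-y) (4y)
  have key' : sinQ (3 * y) • (((3 * y : ℚ) : K₀) • betaQ (1 - y) (4 * y)) -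
      ((y : ℚ) : K₀) • sinQ (3 * y) • betaQ (4 * y) (1 - 3 * y) =
      (sinQ (3 * y) * qsCK y) • betaQ (1 - 3 * y) (1 / 2 + y) := by
    rw [← smul_smul, ← key, smul_sub, smul_comm (sinQ (3 * y)) (((y : ℚ) : K₀))]
  rw [hp] at key'
  refine PropTo.of_smul_eq_smul (c := ((3 * y : ℚ) : K₀) * (sinQ (3 * y) - sinQ y))
    (c' := sinQ (3 * y) * qsCK y)
    (mul_ne_zero (by exact_mod_cast (show (3 * y : ℚ) ≠ 0 by positivity))
      (sinQ_sub_sinQ_ne_zero_of_lt hy (by linarith) (by linarith)))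
    (mul_ne_zero (sinQ_ne_zero (by positivity) (by linarith)) (qsCK_ne_zero hy4)) ?_
  linear_combination (norm := module) key'

/-! ## Instances -/

/-- Level `8`: `β(7/8, 1/2) ≐ β(5/8, 5/8)` — `{4,5,7}` meets `{5,5,6}` (second kind). -/
theorem betaQ_propTo_eight_qs : PropTo (betaQ (7 / 8) (1 / 2)) (betaQ (5 / 8) (5 / 8)) := by
  have h := betaQ_propTo_quarticSecond (1 / 8) (by norm_num) (by norm_num)
  norm_num at h
  exact h

/-- Level `5` (`y = 1/5`): `β(4/5, 4/5) ≐ β(2/5, 7/10)` — a level-`5` class meets level `10`. -/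
theorem betaQ_propTo_ten_qs : PropTo (betaQ (4 / 5) (4 / 5)) (betaQ (2 / 5) (7 / 10)) := by
  have h := betaQ_propTo_quarticSecond (1 / 5) (by norm_num) (by norm_num)
  norm_num at h
  exact h

/-- Level `12`: `β(11/12, 1/3) ≐ β(3/4, 7/12)` — `{4,9,11}` meets `{7,8,9}` (second kind). -/
theorem betaQ_propTo_twelve_qs : PropTo (betaQ (11 / 12) (1 / 3)) (betaQ (3 / 4) (7 / 12)) := by
  have h := betaQ_propTo_quarticSecond (1 / 12) (by norm_num) (by norm_num)
  norm_num at h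
  exact h

/-- Level `16`: `β(15/16, 1/4) ≐ β(13/16, 9/16)` — `{4,13,15}` meets `{9,10,13}` (second kind). -/
theorem betaQ_propTo_sixteen_qs : PropTo (betaQ (15 / 16) (1 / 4)) (betaQ (13 / 16) (9 / 16)) := by
  have h := betaQ_propTo_quarticSecond (1 / 16) (by norm_num) (by norm_num)
  norm_num at h
  exact h

end SoloBlind

end Summit.KontsevichZagierPeriods.KontsevichZagierPeriods.Theorems
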